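import Summits.KontsevichZagierPeriods.KontsevichZagierPeriods.Theorems.TerasomaMultiplicationBetaCancellationOfAyoubPiCancellation
import Summits.KontsevichZagierPeriods.KontsevichZagierPeriods.Theorems.AyoubPiLocalKernel.Negative.LoadBearing
import Summits.KontsevichZagierPeriods.KontsevichZagierPeriods.Theorems.BetaCancellation.Negative.LoadBearing
import Summits.KontsevichZagierPeriods.KontsevichZagierPeriods.Theorems.MzvKernelInKZ.Negative.ScalingDivision
import Literature.NumberTheory.Transcendental.KZCalculusProofs
import Literature.NumberTheory.Transcendental.KZRulesAssociator

/-!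
# `AyoubPiCancellation` (stmt-KontsevichZagierPeriods-0540) — negative knowledge II: boundary of the crux

Companion of `Negative/LoadBearing.lean` (same namespace, same conventions: crux VERBATIM with one
constant mutated, inlined; sorry-free; axioms ⊆ {propext, Classical.choice, Quot.sound}); the two
files are independent of each other.

* §4 BOUNDARY (what makes a padding cancel): `cancellation_of_lift_sub_nsmul_mem` — if
  `lift (of ∘ P) c ≡ k • c` modulo relations for one integer `k ≥ 1`, cancellation for `P` is a
  THEOREM (integer division is a derived rule, `MzvKernelInKZ.Negative.mem_relations_of_nsmul_mem`);
  instance: the UNIT SQUARE `z 0, z 1 ∈ [0,1]` in place of the unit disc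
  (`squarePinned_lift_sub_mem`, `squareCancellation`, `exists_squarePinned`: `P r` is the double
  slab `(r.slab 0).slab 0` — two rule-(3) moves — relabelled by one rule-(2) coordinate
  permutation). Conversely `[π]` is NOT commensurable with `1` modulo the moves
  (`piRep_not_commensurable`: soundness + irrationality of `π`), so this door is closed for the
  disc: the content of the crux is exactly a padding whose class is incommensurable with `1`.
* §5 PROVABLE CASE in the crux's typing: non-negative single generators cancel
  (`cancellation_of_nonneg`: soundness, `∫ f = 0 ∧ f ≥ 0 ⇒ f = 0` a.e., a.e.-zero representations
  are relations).
[cite: KontsevichZagierPeriods2001, §1.2 Conjecture 1 and §4.1] [cite: HuberWustholz2022, App. A.4]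
-/

noncomputable section

open MeasureTheory Set
open Literature.NumberTheory.Transcendental
open Literature.NumberTheory.Transcendental.KZ
open Literature.ModelTheory.ExponentialFields (IsSemialgebraic)

namespace Summit.KontsevichZagierPeriods.AyoubPiCancellationNegative

open Summit.KontsevichZagierPeriods.KontsevichZagierPeriods.BetaCancellationLine
  (exists_pinned piIndex_castAdd_zero piIndex_castAdd_one piIndex_natAdd)
open Summit.KontsevichZagierPeriods.LiouvilleUnfolding.AyoubPiLocalKernelNegative
  (eval_lift of_slab_slab_sub_mem)
open Summit.KontsevichZagierPeriods.MzvKernelInKZ.Negative (mem_relations_of_nsmul_mem)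

/-! ## §4 BOUNDARY: commensurable paddings cancel; `[π]` is incommensurable with `1` -/

/-- **Commensurable paddings cancel.** If a family `P` satisfies `lift (of ∘ P) c − k • c ∈
relations` for all `c`, for one integer `k ≥ 1` (the padding class is `k` times the unit modulo
the moves), then cancellation for `P` is a THEOREM: integer division is a derived rule
(`MzvKernelInKZ.Negative.mem_relations_of_nsmul_mem`). [folklore] -/
theorem cancellation_of_lift_sub_nsmul_mem {d : ℕ} (P : ∀ n : ℕ, IntegralRep n → IntegralRep (n + d))
    {k : ℕ} (hk : 0 < k)
    (hP : ∀ c : FormalRep,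
      FreeAbelianGroup.lift (fun s : (Σ n, IntegralRep n) => of (P s.1 s.2)) c - k • c ∈ relations)
    (c : FormalRep)
    (hc : FreeAbelianGroup.lift (fun s : (Σ n, IntegralRep n) => of (P s.1 s.2)) c ∈ relations) :
    c ∈ relations := by
  refine mem_relations_of_nsmul_mem hk ?_
  have := relations.sub_mem hc (hP c)
  simpa using this

/-- The coordinate relabelling moving the two TRAILING coordinates of `Fin (n + 2)` to the front. -/
theorem squareIndex_eq (n : ℕ) :
    ∃ e : Fin (n + 2) ≃ Fin (n + 2),
      (∀ i : Fin n, e (Fin.castSucc (Fin.castSucc i)) = i.succ.succ) ∧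
        e (Fin.castSucc (Fin.last n)) = 0 ∧ e (Fin.last (n + 1)) = 1 := by
  refine ⟨finAddFlip.trans (finCongr (Nat.add_comm 2 n)), fun i => ?_, ?_, ?_⟩
  · have : (Fin.castSucc (Fin.castSucc i) : Fin (n + 2)) = Fin.castAdd 2 i := Fin.ext rfl
    rw [this, Equiv.trans_apply, finAddFlip_apply_castAdd, piIndex_natAdd]
  · have : (Fin.castSucc (Fin.last n) : Fin (n + 2)) = Fin.natAdd n (0 : Fin 2) := Fin.ext (by simp)
    rw [this, Equiv.trans_apply, finAddFlip_apply_natAdd, piIndex_castAdd_zero]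
  · have : (Fin.last (n + 1) : Fin (n + 2)) = Fin.natAdd n (1 : Fin 2) := Fin.ext (by simp)
    rw [this, Equiv.trans_apply, finAddFlip_apply_natAdd, piIndex_castAdd_one]

/-- **The unit SQUARE in place of the unit disc: `lift (of ∘ P) c ≡ c`.** For the family pinned to
`[0,1]² × σ` (square in the two leading coordinates, integrand of the trailing ones),
`lift (of ∘ P) c − c ∈ relations`: on a generator, `P r` is the double slab `(r.slab 0).slab 0`
(two rule-(3) moves from `r`, `AyoubPiLocalKernelNegative.of_slab_slab_sub_mem`) relabelled by one
rule-(2) coordinate permutation (`KZ.of_sub_of_reindex_mem_relations`). [folklore] -/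
theorem squarePinned_lift_sub_mem (P : ∀ n : ℕ, IntegralRep n → IntegralRep (n + 2))
    (hP : ∀ (n : ℕ) (r : IntegralRep n),
      (P n r).domain = {z : Fin (n + 2) → ℝ | z 0 ∈ Icc (0:ℝ) 1 ∧ z 1 ∈ Icc (0:ℝ) 1 ∧
          (fun i : Fin n => z i.succ.succ) ∈ r.domain} ∧
        (P n r).integrand = fun z => r.integrand (fun i : Fin n => z i.succ.succ))
    (c : FormalRep) :
    FreeAbelianGroup.lift (fun s : (Σ n, IntegralRep n) => of (P s.1 s.2)) c - c ∈ relations := by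
  -- on generators: `P n r = ((r.slab 0).slab 0).reindex e`
  have hgen : ∀ (n : ℕ) (r : IntegralRep n), of (P n r) - of r ∈ relations := by
    intro n r
    obtain ⟨e, he, he0, he1⟩ := squareIndex_eq n
    have hii : ∀ w : Fin (n + 2) → ℝ,
        Fin.init (Fin.init fun i => w (e i)) = fun i : Fin n => w i.succ.succ := fun w => by
      funext i
      simp only [Fin.init, he]
    have hl0 : ∀ w : Fin (n + 2) → ℝ, (Fin.init fun i => w (e i)) (Fin.last n) = w 0 := fun w => by
      simp only [Fin.init, he0]
    have hPe : P n r = ((r.slab 0).slab 0).reindex e := by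
      refine IntegralRep.ext' ?_ ?_
      · rw [(hP n r).1, IntegralRep.reindex_domain]
        ext w
        simp only [mem_setOf_eq, IntegralRep.domain_slab, IntegralRep.slabDomain, hii, hl0, he1,
          Nat.cast_zero, zero_add, mem_Icc]
        tauto
      · rw [(hP n r).2, IntegralRep.reindex_integrand]
        funext w
        simp only [IntegralRep.integrand_slab, hii]
    rw [hPe]
    have h1 := of_sub_of_reindex_mem_relations ((r.slab 0).slab 0) e
    have h2 := of_slab_slab_sub_mem r
    have e3 : of (((r.slab 0).slab 0).reindex e) - of r =
        -(of ((r.slab 0).slab 0) - of (((r.slab 0).slab 0).reindex e)) +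
          (of ((r.slab 0).slab 0) - of r) := by abel
    rw [e3]
    exact relations.add_mem (relations.neg_mem h1) h2
  induction c using FreeAbelianGroup.induction_on with
  | zero => simp [relations.zero_mem]
  | of s =>
    obtain ⟨n, r⟩ := s
    rw [FreeAbelianGroup.lift_apply_of]
    exact hgen n r
  | neg s ih =>
    have e : FreeAbelianGroup.lift (fun s : (Σ n, IntegralRep n) => of (P s.1 s.2))
          (-FreeAbelianGroup.of s) - -FreeAbelianGroup.of s =
        -(FreeAbelianGroup.lift (fun s : (Σ n, IntegralRep n) => of (P s.1 s.2))
          (FreeAbelianGroup.of s) - FreeAbelianGroup.of s) := by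
      rw [map_neg]; abel
    rw [e]
    exact relations.neg_mem ih
  | add x y hx hy =>
    rw [map_add]
    have e : FreeAbelianGroup.lift (fun s : (Σ n, IntegralRep n) => of (P s.1 s.2)) x +
        FreeAbelianGroup.lift (fun s : (Σ n, IntegralRep n) => of (P s.1 s.2)) y - (x + y) =
        (FreeAbelianGroup.lift (fun s : (Σ n, IntegralRep n) => of (P s.1 s.2)) x - x) +
          (FreeAbelianGroup.lift (fun s : (Σ n, IntegralRep n) => of (P s.1 s.2)) y - y) := by
      abel
    rw [e]
    exact relations.add_mem hx hy

/-- **SQUARE CANCELLATION is a theorem**: the crux with the unit disc `z 0 ^ 2 + z 1 ^ 2 ≤ 1`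
replaced by the unit square `z 0, z 1 ∈ [0,1]` HOLDS (`k = 1` in
`cancellation_of_lift_sub_nsmul_mem`). The content of the crux is therefore exactly that the
padding class `[π]` is not (known to be) commensurable with `1` modulo the moves — and it is
provably NOT commensurable (`piRep_not_commensurable`). [folklore] -/
theorem squareCancellation :
    ∀ P : ∀ n : ℕ, IntegralRep n → IntegralRep (n + 2),
      (∀ (n : ℕ) (r : IntegralRep n),
        (P n r).domain = {z : Fin (n + 2) → ℝ | z 0 ∈ Icc (0:ℝ) 1 ∧ z 1 ∈ Icc (0:ℝ) 1 ∧
            (fun i : Fin n => z i.succ.succ) ∈ r.domain} ∧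
          (P n r).integrand = fun z => r.integrand (fun i : Fin n => z i.succ.succ)) →
      ∀ c : FormalRep,
        FreeAbelianGroup.lift (fun s : (Σ n, IntegralRep n) => of (P s.1 s.2)) c ∈ relations →
          c ∈ relations := by
  intro P hP c hc
  have := relations.sub_mem hc (squarePinned_lift_sub_mem P hP c)
  simpa using this

/-- The square-pinned family exists (non-vacuity of `squareCancellation`). [folklore] -/
theorem exists_squarePinned :
    ∃ P : ∀ n : ℕ, IntegralRep n → IntegralRep (n + 2),
      ∀ (n : ℕ) (r : IntegralRep n),
        (P n r).domain = {z : Fin (n + 2) → ℝ | z 0 ∈ Icc (0:ℝ) 1 ∧ z 1 ∈ Icc (0:ℝ) 1 ∧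
            (fun i : Fin n => z i.succ.succ) ∈ r.domain} ∧
          (P n r).integrand = fun z => r.integrand (fun i : Fin n => z i.succ.succ) := by
  have hE : ∀ n : ℕ, ∃ e : Fin (n + 2) ≃ Fin (n + 2),
      (∀ i : Fin n, e (Fin.castSucc (Fin.castSucc i)) = i.succ.succ) ∧
        e (Fin.castSucc (Fin.last n)) = 0 ∧ e (Fin.last (n + 1)) = 1 := squareIndex_eq
  choose e he he0 he1 using hE
  have hii : ∀ (n : ℕ) (w : Fin (n + 2) → ℝ),
      Fin.init (Fin.init fun i => w (e n i)) = fun i : Fin n => w i.succ.succ := fun n w => by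
    funext i
    simp only [Fin.init, he]
  have hl0 : ∀ (n : ℕ) (w : Fin (n + 2) → ℝ), (Fin.init fun i => w (e n i)) (Fin.last n) = w 0 :=
    fun n w => by simp only [Fin.init, he0]
  refine ⟨fun n r => ((r.slab 0).slab 0).reindex (e n), fun n r => ⟨?_, ?_⟩⟩
  · rw [IntegralRep.reindex_domain]
    ext w
    simp only [mem_setOf_eq, IntegralRep.domain_slab, IntegralRep.slabDomain, hii, hl0, he1,
      Nat.cast_zero, zero_add, mem_Icc]
    tauto
  · rw [IntegralRep.reindex_integrand]
    funext w
    simp only [IntegralRep.integrand_slab, hii]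

/-- **`[π]` is incommensurable with `1` modulo the moves**: `b • [π] − a • [pt, 1] ∈ relations`
forces `a = b = 0` (soundness: `b π = a`, and `π` is irrational). So the trivial door of §4 is
closed for the disc padding; a proof of the crux must cancel a class that no integer multiple
brings to the unit. [folklore] -/
theorem piRep_not_commensurable {a b : ℕ} (h : b • of piRep - a • of IntegralRep.unit ∈ relations) :
    a = 0 ∧ b = 0 := by
  have h0 : eval (b • of piRep - a • of IntegralRep.unit) = 0 := relations_le_ker_eval_holds h
  rw [map_sub, map_nsmul, map_nsmul, eval_of_piRep, eval_of, IntegralRep.value_unit,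
    nsmul_eq_mul, nsmul_eq_mul, mul_one, sub_eq_zero] at h0
  by_cases hb : b = 0
  · subst hb
    simp at h0
    exact ⟨by exact_mod_cast h0.symm, rfl⟩
  · exfalso
    have : Real.pi = (a : ℝ) / b := by
      field_simp
      linarith
    exact irrational_pi.ne_rational a b (by rw [this]; push_cast; ring)

/-! ## §5 PROVABLE CASES in the crux's typing -/

/-- **Non-negative single generators cancel**: if `r.integrand ≥ 0` on `r.domain` then
`lift (of ∘ P) [r] ∈ relations → [r] ∈ relations` (soundness: `π · value r = 0`; a non-negative
integrable function with integral `0` vanishes a.e.; a.e.-zero representations are relations,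
`BetaCancellationNegative.of_mem_relations_of_ae_eq_zero`). The crux has content only for
sign-changing (or multi-term) combinations. [folklore] -/
theorem cancellation_of_nonneg (P : ∀ n : ℕ, IntegralRep n → IntegralRep (n + 2))
    (hP : ∀ (n : ℕ) (r : IntegralRep n),
      (P n r).domain = {z : Fin (n + 2) → ℝ | z 0 ^ 2 + z 1 ^ 2 ≤ 1 ∧
          (fun i : Fin n => z i.succ.succ) ∈ r.domain} ∧
        (P n r).integrand = fun z => r.integrand (fun i : Fin n => z i.succ.succ))
    {n : ℕ} (r : IntegralRep n) (hr : ∀ x ∈ r.domain, 0 ≤ r.integrand x)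
    (h : FreeAbelianGroup.lift (fun s : (Σ n, IntegralRep n) => of (P s.1 s.2)) (of r) ∈ relations) :
    of r ∈ relations := by
  have hval : r.value = 0 := by
    have h0 : eval (FreeAbelianGroup.lift (fun s : (Σ n, IntegralRep n) => of (P s.1 s.2)) (of r)) =
        0 := relations_le_ker_eval_holds h
    rw [eval_lift P hP, eval_of] at h0
    exact (mul_eq_zero.mp h0).resolve_left Real.pi_ne_zero
  refine Summit.KontsevichZagierPeriods.KontsevichZagierPeriods.BetaCancellationNegative.of_mem_relations_of_ae_eq_zero r ?_
  have hint := r.integrableOn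
  have hae : (0 : (Fin n → ℝ) → ℝ) ≤ᵐ[volume.restrict r.domain] r.integrand :=
    (ae_restrict_iff' (IntegralRep.measurableSet_domain_holds r)).2
      (Filter.Eventually.of_forall fun x hx => hr x hx)
  have := (integral_eq_zero_iff_of_nonneg_ae hae hint).1 hval
  exact this

end Summit.KontsevichZagierPeriods.AyoubPiCancellationNegative

end
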